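import Literature.MathematicalPhysics.QuantumFieldTheory.Balaban1983to89.InfiniteVolumeSufficientXXI
import HarnessLib

/-!
# Sufficient conditions for the infinite-volume limit, XXII — `SU(N)`, `N ≥ 3`: THE SINGLE WILSON LOOPS DO NOT
# SPAN (a kernel NEGATIVE), so `(W-single)`-density stops at `N = 2`

Angle (cell pub-balaban, part IR-1): volume-uniform observable bounds / the infinite-volume limit — what uniformity
in the volume the published bounds do and do not give, and THE EXACT MISSING ESTIMATE.  This module is sorry-free
and cites only published theorems; nothing from the manuscripts under audit is used.

## Where modules XIX–XXI left the question

* XIX: `(3a)` "the torus states have a unique infinite-volume limit" (`HasUniqueInfiniteVolumeLimit`) ⟺ `(W-corr)`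
  "every finite Wilson-loop CORRELATION converges as `L → ∞`" (`HasWilsonLoopCorrelationLimits`) UNDER the density
  hypothesis `SpansGaugeInvariantCylinders d (wilsonLoopProducts ρ d)` — the real span of the PRODUCTS of
  `Re/Im tr ρ(U_ℓ)` is sup-norm dense in the gauge-invariant continuous bounded cylinders (the shape of Sengupta 1994
  Thm 4 / Lévy 2004 Thm 3.1: the ALGEBRA generated by the Wilson loops is dense).
* XX–XXI: the same with the SINGLE loops, `SpansGaugeInvariantCylinders d (range (loopFactor ρ))`, gives
  `(3a) ⟺ (W-single)` (`hasUniqueInfiniteVolumeLimit_iff_hasWilsonLoopLimits_of_spans`); this single-loop density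
  was PROVED for `U(1)` (XX) and for `SU(2)` (XXI `spansGaugeInvariantCylinders_loopFactor_su2`, through the Fricke /
  Mandelstam identity `tr g · tr h = tr(gh) + tr(gh⁻¹)`, which turns every product of loops into a sum of single
  loops), and XXI's "Not claimed" left `N ≥ 3` open, the cell's census (`ir/SUFFICIENT.md` §26.5 (T-single-loop))
  asking whether single loops still suffice there.

## What this module proves (kernel-checked; `G = SU(n+3) = Matrix.specialUnitaryGroup (Fin (n+3)) ℂ`, every `n d : ℕ`)

THEY DO NOT.  `not_spansGaugeInvariantCylinders_loopFactor_suN` (PART D):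
`¬ SpansGaugeInvariantCylinders (d+2) (range (loopFactor (fundamentalRep (Fin (n+3)))))` — for every `N ≥ 3`
(`not_spansGaugeInvariantCylinders_loopFactor_of_three_le`) and every lattice dimension `≥ 2`, the real linear span
of the single Wilson loops `Re tr U_ℓ`, `Im tr U_ℓ` (all based lattice loops `ℓ`, defining representation) is NOT
sup-norm dense in the gauge-invariant continuous bounded cylinder observables.  The witness is Haar-free and finite:

* PART A — an EIGENVALUE-BALANCED FAMILY in the diagonal torus of `SU(n+3)`: `g_A = diag(i,-i,1,1,…)`,
  `g_E = diag(-1,-1,1,1,…)`, `g_C = diag(i,i,-1,1,…)`, `g_D = diag(-i,-i,-1,1,…)` and `1`; the eigenvalue multisets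
  satisfy `{g_C} + {g_D} + {1} = 2{g_A} + {g_E}`, so `tr g_C^k + tr g_D^k + tr 1 - 2 tr g_A^k - tr g_E^k = 0` for EVERY
  `k : ℕ` (`trace_balanced_identity`, by `ring` on `i^k, (-i)^k, (-1)^k`), and all five have order dividing `4`.
* PART B — on the SINGLE-EDGE configuration `U_g` (`g` on the edge `e₀ = (0,0)`, `1` elsewhere) the holonomy of ANY
  lattice walk is `g ^ s` with an exponent `s = walkExp e₀ ℓ ∈ ℕ` depending on the walk only
  (`walkHolonomy_singleEdgeConfig`; a backward traversal contributes `g⁻¹ = g³`).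
* PART C — hence the five-point functional `Λ(W) = W(U_{g_C}) + W(U_{g_D}) + W(U_1) - 2W(U_{g_A}) - W(U_{g_E})`
  VANISHES on every single Wilson loop and on their real span (`fivePoint_eq_zero_of_mem_span`).
* PART D — but on the gauge-invariant continuous bounded 4-edge cylinder `P(U) = |tr U_p|²` (`p` the plaquette at the
  origin; `P(U_g) = |tr g|²` takes the values `(n-1)²+4, (n-1)²+4, (n+3)², (n+1)², (n-1)²`) it equals
  `Λ(P) = 16` (`fivePoint_absTrSqPlaquette`); a `W` in the span with `sup |P - W| ≤ 1` would give `16 ≤ 6`.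
  Quantitatively every element of the span is at sup-distance `≥ 8/3` from `P` (`le_dist_absTrSqPlaquette_of_mem_span`).
* PART E — `P = (Re tr U_p)² + (Im tr U_p)²` IS a sum of two Wilson-loop PRODUCTS (`absTrSqPlaquette_eq_loopProduct_add`,
  via `walkHolonomy_rectWalk_one_one : hol(rectWalk x i j 1 1) = U_p`), so for `N ≥ 3` the span of Lévy's product class
  is NOT inside the (closed) span of the single loops (`not_span_wilsonLoopProducts_le_span_loopFactor_suN`), and NO
  product-to-sum formula of module XXI's shape `χ_{b₁}(g)χ_{b₂}(h) = c₁χ_b(gh) + c₂χ_b(gh⁻¹)` exists for `SU(n+3)`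
  (`not_prod_formula_suN`: on the diagonal of the family the two sides sum to `8` and `0`) — module XXI's PART A route
  is closed for `N ≥ 3`.
* PART F — STATE-LEVEL FORM (`exists_states_agree_on_single_loops_suN`): the probability measures
  `μ = (δ_{U_{g_C}} + δ_{U_{g_D}} + δ_{U_1})/3` and `ν = (2δ_{U_{g_A}} + δ_{U_{g_E}})/3` on `LGConfig (d+2) SU(n+3)` have
  the SAME expectation of every single Wilson loop (`integral_loopFactor_stateμ_eq_stateν`) and DIFFER by `16/3` on
  the gauge-invariant cylinder `P`: for `N ≥ 3` the single-loop expectations do not determine a state, not even on the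
  gauge-invariant local observables.  (These five-atom states are neither gauge invariant nor Gibbs; they decide the
  KINEMATIC question only — see "Not claimed".)

In print.  The dichotomy `N = 2` / `N ≥ 3` is the Mandelstam-identity count: for a special `N × N` group the identity
`M_N(γ₁∘γ, …, γ_N∘γ) = M_N(γ₁, …, γ_N)` «allow[s] us, for a special group, to express the product of N Wilson loops in
terms of that of N-1» (Gambini–Pullin 1996, §3.4.1 'Mandelstam identities', eq. (3.44); held copy chunk-indexed,
chunk 69), which for `N = 2` is `W(γ₁)W(γ₂) = W(γ₁∘γ₂⁻¹) + W(γ₁∘γ₂)` (ibid. eq. (3.48); module XXI's Fricke identity)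
and for `N = 3` only reduces TRIPLE products to double ones;
that the double product `|tr U_p|²` (the adjoint plaquette `+ 1`) is then irreducible — not even approximable — is what
PART D/E prove (whereas e.g. `Re (tr U_p)²` DOES reduce on `SU(3)`: Cayley–Hamilton gives `(tr g)² = tr g² + 2·conj (tr g)`
there, so not every double product is irreducible at `N = 3`).  Sengupta 1994 (Proc. AMS
121) Thm 4 p.904 determines the Yang–Mills measure from «expectation values of products of characters evaluated on
holonomy variables» (introduction p.897; the abstract, same page, has «(products of characters evaluated on
holonomies)») through the subALGEBRA `𝓑_j` generated by the `χ(g_{i₁}⋯g_{i_k})` and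
Stone–Weierstrass (p.904); the present module shows that for `SU(N)`, `N ≥ 3`, "algebra" cannot be weakened to
"linear span" in the defining representation (for `N = 2` it can, module XXI).  At `N = ∞` the factorisation
`⟨O₁O₂⟩ = ⟨O₁⟩⟨O₂⟩ + O(1/N²)` (Greensite 2011, §12.1 eq. (12.5); held copy chunk 162: «a striking property of the N=∞
limit which seems quite unlike the case for N=2 or N=3») would make products redundant IN EXPECTATION — a property of
states, not of the observable algebra, and not available at finite `N`.

## Census consequence (cell record `ir/SUFFICIENT.md` §27)

For `SU(N)`, `N ≥ 3`: `(3a) ⟹ (W-single)` (XX `hasWilsonLoopLimits_of_hasUniqueInfiniteVolumeLimit`) stands, but the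
dense-class route to the converse is CLOSED by a theorem, not by a missing lemma; the exact missing estimate stays, as
in XIX/XXI, Cauchy-in-`L` of ALL finite Wilson-loop CORRELATIONS (given orbit separation `TraceWordsSeparateOrbits
(fundamentalRep (Fin N))`, in print as Sengupta 1994 Thm 2 p.900, not kernel-proved), equivalently of the expectations
of the two-loop observables such as `|tr U_p|²` that single loops provably miss.

## Not claimed

No statement about the Wilson lattice Yang–Mills torus states: whether for THOSE states convergence of the single-loop
expectations forces convergence of all correlations at `N ≥ 3` (a dynamical question) is untouched — only the
kinematic implication "single-loop density" is refuted, and the witnesses `μ, ν` are finitely supported, not gauge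
invariant and not Gibbs.  Nothing for representations other than the defining one (`P - 1` is the ADJOINT character
of `U_p`, so single loops in the adjoint representation do see this witness).  No continuum statement; no statement of
the audited manuscripts is used or assessed.  NOT summit progress.

VERSIONS: v1 (gen 22, p193222).  v1.1 (gen 23): prose only — the "In print" paragraph above no longer over-generalises
«double products irreducible at N = 3» (only `|tr U_p|²` is proved irreducible; DOCFIX D1 of cross-read C-pv14-125) and
attributes the Sengupta span to the introduction (INFO I2, ibid.); declarations byte-identical to v1.
-/

namespace Literature.MathematicalPhysics.QuantumFieldTheory

open Literature.MathematicalPhysics.QuantumLattice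
open Literature.Probability.LatticeModels (zdGraph)
open Balaban1983to89.Missing (SpansGaugeInvariantCylinders)

section DiagonalFamily

variable {n : ℕ}

/-! ## PART A — AN EIGENVALUE-BALANCED FIVE-POINT FAMILY IN THE DIAGONAL TORUS OF `SU(n+3)` -/

/-- The diagonal vector `(a, b, c, 1, …, 1) ∈ ℂ^{n+3}`. [folklore] -/
def diagPad3 (n : ℕ) (a b c : ℂ) : Fin (n + 3) → ℂ := fun i =>
  if i.val = 0 then a else if i.val = 1 then b else if i.val = 2 then c else 1

/-- Powers act entrywise on the padded diagonal vector. [folklore] -/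
theorem diagPad3_pow (a b c : ℂ) (k : ℕ) : (diagPad3 n a b c) ^ k = diagPad3 n (a ^ k) (b ^ k) (c ^ k) := by
  funext i
  simp only [Pi.pow_apply, diagPad3]
  split_ifs <;> simp

/-- All entries of `diag(a,b,c,1,…)` have norm one when `a, b, c` do. [folklore] -/
theorem norm_diagPad3 {a b c : ℂ} (ha : ‖a‖ = 1) (hb : ‖b‖ = 1) (hc : ‖c‖ = 1) (i : Fin (n + 3)) :
    ‖diagPad3 n a b c i‖ = 1 := by
  simp only [diagPad3]
  split_ifs <;> simp [ha, hb, hc]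

/-- `Σᵢ diag(a,b,c,1,…)ᵢ = a + b + c + n`. [folklore] -/
theorem sum_diagPad3 (a b c : ℂ) : ∑ i, diagPad3 n a b c i = a + b + c + n := by
  simp [diagPad3, Fin.sum_univ_succ]
  ring

/-- `∏ᵢ diag(a,b,c,1,…)ᵢ = abc`. [folklore] -/
theorem prod_diagPad3 (a b c : ℂ) : ∏ i, diagPad3 n a b c i = a * b * c := by
  simp [diagPad3, Fin.prod_univ_succ, mul_assoc]

/-- The diagonal element `diag(a, b, c, 1, …, 1)` of `SU(n+3)` for unit complex numbers with `abc = 1`. [folklore] -/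
def suDiag3 (n : ℕ) (a b c : ℂ) (ha : ‖a‖ = 1) (hb : ‖b‖ = 1) (hc : ‖c‖ = 1) (habc : a * b * c = 1) :
    Matrix.specialUnitaryGroup (Fin (n + 3)) ℂ :=
  ⟨Matrix.diagonal (diagPad3 n a b c),
    (diagonal_mem_specialUnitaryGroup_iff _).2 ⟨norm_diagPad3 ha hb hc, by rw [prod_diagPad3, habc]⟩⟩

/-- The matrix of `suDiag3^k` is `diag(a^k, b^k, c^k, 1, …)`. [folklore] -/
theorem coe_suDiag3_pow (a b c : ℂ) (ha : ‖a‖ = 1) (hb : ‖b‖ = 1) (hc : ‖c‖ = 1) (habc : a * b * c = 1) (k : ℕ) :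
    ((suDiag3 n a b c ha hb hc habc ^ k : Matrix.specialUnitaryGroup (Fin (n + 3)) ℂ) :
      Matrix (Fin (n + 3)) (Fin (n + 3)) ℂ)
      = Matrix.diagonal (diagPad3 n (a ^ k) (b ^ k) (c ^ k)) := by
  rw [SubmonoidClass.coe_pow]
  show (Matrix.diagonal (diagPad3 n a b c)) ^ k = _
  rw [Matrix.diagonal_pow, diagPad3_pow]

/-- `tr suDiag3^k = a^k + b^k + c^k + n` (the power sums of the eigenvalues). [folklore] -/
theorem trace_coe_suDiag3_pow (a b c : ℂ) (ha : ‖a‖ = 1) (hb : ‖b‖ = 1) (hc : ‖c‖ = 1) (habc : a * b * c = 1) (k : ℕ) :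
    ((suDiag3 n a b c ha hb hc habc ^ k : Matrix.specialUnitaryGroup (Fin (n + 3)) ℂ) :
      Matrix (Fin (n + 3)) (Fin (n + 3)) ℂ).trace = a ^ k + b ^ k + c ^ k + n := by
  rw [coe_suDiag3_pow, Matrix.trace_diagonal, sum_diagPad3]

/-- `suDiag3^4 = 1` when `a^4 = b^4 = c^4 = 1`. [folklore] -/
theorem suDiag3_pow_four (a b c : ℂ) (ha : ‖a‖ = 1) (hb : ‖b‖ = 1) (hc : ‖c‖ = 1) (habc : a * b * c = 1)
    (ha4 : a ^ 4 = 1) (hb4 : b ^ 4 = 1) (hc4 : c ^ 4 = 1) : suDiag3 n a b c ha hb hc habc ^ 4 = 1 := by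
  apply Subtype.ext
  rw [coe_suDiag3_pow, ha4, hb4, hc4]
  show Matrix.diagonal (diagPad3 n 1 1 1) = 1
  rw [← Matrix.diagonal_one]
  congr 1
  funext i
  simp [diagPad3]

/-! ### The eigenvalue-balanced family -/

/-- `(-i)^4 = 1`. [folklore] -/
theorem negI_pow_four : (-Complex.I : ℂ) ^ 4 = 1 := by
  rw [(by decide : (4 : ℕ) = 2 * 2), pow_mul, neg_sq, Complex.I_sq, neg_one_sq]
/-- `(-1)^4 = 1` in `ℂ`. [folklore] -/
theorem negOne_pow_four : (-1 : ℂ) ^ 4 = 1 := by norm_num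

/-- `g_A = diag(i, -i, 1, 1, …)`, an element of `SU(n+3)` of order dividing `4`. [folklore] -/
def balA (n : ℕ) : Matrix.specialUnitaryGroup (Fin (n + 3)) ℂ :=
  suDiag3 n Complex.I (-Complex.I) 1 Complex.norm_I (by rw [norm_neg, Complex.norm_I]) norm_one (by simp)
/-- `g_E = diag(-1, -1, 1, 1, …)`, an element of `SU(n+3)` of order dividing `4`. [folklore] -/
def balE (n : ℕ) : Matrix.specialUnitaryGroup (Fin (n + 3)) ℂ :=
  suDiag3 n (-1) (-1) 1 (by rw [norm_neg, norm_one]) (by rw [norm_neg, norm_one]) norm_one (by simp)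
/-- `g_C = diag(i, i, -1, 1, …)`, an element of `SU(n+3)` of order dividing `4`. [folklore] -/
def balC (n : ℕ) : Matrix.specialUnitaryGroup (Fin (n + 3)) ℂ :=
  suDiag3 n Complex.I Complex.I (-1) Complex.norm_I Complex.norm_I (by rw [norm_neg, norm_one]) (by simp)
/-- `g_D = diag(-i, -i, -1, 1, …)`, an element of `SU(n+3)` of order dividing `4`. [folklore] -/
def balD (n : ℕ) : Matrix.specialUnitaryGroup (Fin (n + 3)) ℂ :=
  suDiag3 n (-Complex.I) (-Complex.I) (-1) (by rw [norm_neg, Complex.norm_I]) (by rw [norm_neg, Complex.norm_I])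
    (by rw [norm_neg, norm_one]) (by simp)

/-- `g_A^4 = 1`. [folklore] -/
theorem balA_pow_four : balA n ^ 4 = 1 := suDiag3_pow_four _ _ _ _ _ _ _ Complex.I_pow_four negI_pow_four (one_pow 4)
/-- `g_E^4 = 1`. [folklore] -/
theorem balE_pow_four : balE n ^ 4 = 1 := suDiag3_pow_four _ _ _ _ _ _ _ negOne_pow_four negOne_pow_four (one_pow 4)
/-- `g_C^4 = 1`. [folklore] -/
theorem balC_pow_four : balC n ^ 4 = 1 :=
  suDiag3_pow_four _ _ _ _ _ _ _ Complex.I_pow_four Complex.I_pow_four negOne_pow_four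
/-- `g_D^4 = 1`. [folklore] -/
theorem balD_pow_four : balD n ^ 4 = 1 := suDiag3_pow_four _ _ _ _ _ _ _ negI_pow_four negI_pow_four negOne_pow_four

/-- **THE TRACE IDENTITY**: for every `k : ℕ`, `tr g_C^k + tr g_D^k + tr 1^k - 2 tr g_A^k - tr g_E^k = 0` in the defining
representation of `SU(n+3)` — the eigenvalue multisets balance, `{i,i,-1} + {-i,-i,-1} + {1,1,1} = 2{i,-i,1} + {-1,-1,1}`
(the padding `1`s cancel), so all power sums agree. [folklore] -/
theorem trace_balanced_identity (k : ℕ) :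
    ((balC n ^ k : Matrix.specialUnitaryGroup (Fin (n + 3)) ℂ) : Matrix (Fin (n + 3)) (Fin (n + 3)) ℂ).trace
      + ((balD n ^ k : Matrix.specialUnitaryGroup (Fin (n + 3)) ℂ) : Matrix (Fin (n + 3)) (Fin (n + 3)) ℂ).trace
      + (((1 : Matrix.specialUnitaryGroup (Fin (n + 3)) ℂ) ^ k : Matrix.specialUnitaryGroup (Fin (n + 3)) ℂ) :
          Matrix (Fin (n + 3)) (Fin (n + 3)) ℂ).trace
      - 2 * ((balA n ^ k : Matrix.specialUnitaryGroup (Fin (n + 3)) ℂ) : Matrix (Fin (n + 3)) (Fin (n + 3)) ℂ).trace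
      - ((balE n ^ k : Matrix.specialUnitaryGroup (Fin (n + 3)) ℂ) : Matrix (Fin (n + 3)) (Fin (n + 3)) ℂ).trace = 0 := by
  rw [balC, balD, balA, balE, trace_coe_suDiag3_pow, trace_coe_suDiag3_pow, trace_coe_suDiag3_pow, trace_coe_suDiag3_pow,
    one_pow, OneMemClass.coe_one, Matrix.trace_one, Fintype.card_fin]
  push_cast
  ring

end DiagonalFamily

/-! ## PART B — SINGLE-EDGE CONFIGURATIONS: EVERY LOOP HOLONOMY IS A POWER OF THE EDGE VARIABLE -/

section SingleEdge

variable {d : ℕ} {G : Type*} [Group G]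

/-- The configuration with `g` on the (positively oriented) edge `e₀` and `1` on every other edge. [folklore] -/
def singleEdgeConfig (e₀ : ZdEdge d) (g : G) : LGConfig d G := fun e => if e = e₀ then g else 1

/-- `U_g(e₀) = g`. [folklore] -/
@[simp] theorem singleEdgeConfig_self (e₀ : ZdEdge d) (g : G) : singleEdgeConfig e₀ g e₀ = g := by
  simp [singleEdgeConfig]

/-- `U_g(e) = 1` off `e₀`. [folklore] -/
theorem singleEdgeConfig_of_ne {e₀ e : ZdEdge d} (h : e ≠ e₀) (g : G) : singleEdgeConfig e₀ g e = 1 := by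
  simp [singleEdgeConfig, h]

/-- The exponent picked up by a dart: `1` along `e₀` forwards, `3` (`= -1 mod 4`) along `e₀` backwards, `0` along any
other edge. [folklore] -/
noncomputable def dartExp (e₀ : ZdEdge d) (e : (zdGraph d).Dart) : ℕ :=
  if (dartStep e).1 = e₀ then (if (dartStep e).2 then 1 else 3) else 0

/-- The total exponent of a walk: the sum of the dart exponents (it depends on the walk only, not on `g`). [folklore] -/
noncomputable def walkExp (e₀ : ZdEdge d) {x y : Fin d → ℤ} (w : (zdGraph d).Walk x y) : ℕ :=
  (w.darts.map (dartExp e₀)).sum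

/-- For `g` of order dividing `4`, the holonomy of `singleEdgeConfig e₀ g` along a dart is `g ^ dartExp e₀ e`.
[folklore] -/
theorem dartHolonomy_singleEdgeConfig (e₀ : ZdEdge d) {g : G} (hg : g ^ 4 = 1) (e : (zdGraph d).Dart) :
    dartHolonomy (singleEdgeConfig e₀ g) e = g ^ dartExp e₀ e := by
  have hinv : g⁻¹ = g ^ 3 := inv_eq_of_mul_eq_one_right (by rw [← pow_succ', hg])
  unfold dartHolonomy dartExp
  by_cases h1 : (dartStep e).1 = e₀
  · rw [h1, singleEdgeConfig_self]
    cases (dartStep e).2 <;> simp [hinv]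
  · rw [singleEdgeConfig_of_ne h1]
    cases (dartStep e).2 <;> simp [h1]

/-- … hence along any list of darts the holonomy is `g ^ (Σ exponents)` … [folklore] -/
theorem prod_map_dartHolonomy_singleEdgeConfig (e₀ : ZdEdge d) {g : G} (hg : g ^ 4 = 1) :
    ∀ l : List ((zdGraph d).Dart),
      (l.map (dartHolonomy (singleEdgeConfig e₀ g))).prod = g ^ (l.map (dartExp e₀)).sum
  | [] => by simp
  | e :: l => by
    rw [List.map_cons, List.prod_cons, List.map_cons, List.sum_cons, pow_add,
      dartHolonomy_singleEdgeConfig e₀ hg, prod_map_dartHolonomy_singleEdgeConfig e₀ hg l]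

/-- … and along any walk `w` it is `g ^ walkExp e₀ w`. [folklore] -/
theorem walkHolonomy_singleEdgeConfig (e₀ : ZdEdge d) {g : G} (hg : g ^ 4 = 1) {x y : Fin d → ℤ}
    (w : (zdGraph d).Walk x y) : walkHolonomy (singleEdgeConfig e₀ g) w = g ^ walkExp e₀ w :=
  prod_map_dartHolonomy_singleEdgeConfig e₀ hg w.darts

variable {N : ℕ} (ρ : G →* Matrix (Fin N) (Fin N) ℂ)

/-- Every single Wilson-loop generator evaluated at `singleEdgeConfig e₀ g` is `χ_b(g ^ s)` with an exponent
`s = walkExp e₀ ℓ` that does NOT depend on `g`. [folklore] -/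
theorem loopFactor_singleEdgeConfig (e₀ : ZdEdge d) {g : G} (hg : g ^ 4 = 1)
    (p : (Σ x : (Fin d → ℤ), (zdGraph d).Walk x x) × Bool) :
    loopFactor ρ p (singleEdgeConfig e₀ g) = tracePart ρ p.2 (g ^ walkExp e₀ p.1.2) := by
  obtain ⟨ℓ, b⟩ := p
  rw [loopFactor_eq_tracePart, walkHolonomy_singleEdgeConfig e₀ hg]

end SingleEdge

/-! ## PART C — THE FIVE-POINT FUNCTIONAL ANNIHILATES THE SPAN OF THE SINGLE WILSON LOOPS OF `SU(N)`, `N ≥ 3` -/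

section FivePoint

variable {d n : ℕ}

/-- Abbreviation: the defining representation of `SU(n+3)` (tree `fundamentalRep`). [folklore] -/
abbrev ρSU (n : ℕ) : Matrix.specialUnitaryGroup (Fin (n + 3)) ℂ →* Matrix (Fin (n + 3)) (Fin (n + 3)) ℂ :=
  fundamentalRep (Fin (n + 3))

/-- The base edge `e₀ = (0, 0)` (origin, direction `0`) of `ℤ^{d+2}`. [folklore] -/
def baseEdge (d : ℕ) : ZdEdge (d + 2) := ((0 : Fin (d + 2) → ℤ), (0 : Fin (d + 2)))

/-- The test configurations `U_g := singleEdgeConfig e₀ g` (`g` on `e₀`, `1` elsewhere). [folklore] -/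
def cfg (d n : ℕ) (g : Matrix.specialUnitaryGroup (Fin (n + 3)) ℂ) :
    LGConfig (d + 2) (Matrix.specialUnitaryGroup (Fin (n + 3)) ℂ) :=
  singleEdgeConfig (baseEdge d) g

/-- THE FIVE-POINT FUNCTIONAL `Λ(W) = W(U_{g_C}) + W(U_{g_D}) + W(U_1) - 2 W(U_{g_A}) - W(U_{g_E})` on observables.
[folklore] -/
def fivePoint (d n : ℕ) (W : LGConfig (d + 2) (Matrix.specialUnitaryGroup (Fin (n + 3)) ℂ) → ℝ) : ℝ :=
  W (cfg d n (balC n)) + W (cfg d n (balD n)) + W (cfg d n 1) - 2 * W (cfg d n (balA n)) - W (cfg d n (balE n))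

/-- The trace identity through `tracePart`: for every `b` and every exponent `s`,
`χ_b(g_C^s) + χ_b(g_D^s) + χ_b(1^s) - 2 χ_b(g_A^s) - χ_b(g_E^s) = 0`. [folklore] -/
theorem tracePart_identity (b : Bool) (s : ℕ) :
    tracePart (ρSU n) b (balC n ^ s) + tracePart (ρSU n) b (balD n ^ s) + tracePart (ρSU n) b (1 ^ s)
      - 2 * tracePart (ρSU n) b (balA n ^ s) - tracePart (ρSU n) b (balE n ^ s) = 0 := by
  have h := trace_balanced_identity (n := n) s
  cases b
  · have := congrArg Complex.im h
    simpa [tracePart, ρSU, fundamentalRep_apply, Complex.sub_im, Complex.add_im, Complex.mul_im] using this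
  · have := congrArg Complex.re h
    simpa [tracePart, ρSU, fundamentalRep_apply, Complex.sub_re, Complex.add_re, Complex.mul_re] using this

/-- **`Λ` vanishes on every single Wilson-loop generator of `SU(n+3)`** … [folklore] -/
theorem fivePoint_loopFactor (p : (Σ x : (Fin (d + 2) → ℤ), (zdGraph (d + 2)).Walk x x) × Bool) :
    fivePoint d n (loopFactor (ρSU n) p) = 0 := by
  simp only [fivePoint, cfg, loopFactor_singleEdgeConfig (ρSU n) (baseEdge d) balC_pow_four,
    loopFactor_singleEdgeConfig (ρSU n) (baseEdge d) balD_pow_four,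
    loopFactor_singleEdgeConfig (ρSU n) (baseEdge d) (one_pow 4),
    loopFactor_singleEdgeConfig (ρSU n) (baseEdge d) balA_pow_four,
    loopFactor_singleEdgeConfig (ρSU n) (baseEdge d) balE_pow_four]
  exact tracePart_identity p.2 _

/-- **… hence on the whole real span of the single Wilson loops.** [folklore] -/
theorem fivePoint_eq_zero_of_mem_span {W : LGConfig (d + 2) (Matrix.specialUnitaryGroup (Fin (n + 3)) ℂ) → ℝ}
    (hW : W ∈ Submodule.span ℝ (Set.range (loopFactor (d := d + 2) (ρSU n)))) : fivePoint d n W = 0 := by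
  induction hW using Submodule.span_induction with
  | mem w hw =>
    obtain ⟨p, rfl⟩ := hw
    exact fivePoint_loopFactor p
  | zero => simp [fivePoint]
  | add w₁ w₂ _ _ h₁ h₂ =>
    simp only [fivePoint, Pi.add_apply] at h₁ h₂ ⊢
    linarith
  | smul c w _ h =>
    simp only [fivePoint, Pi.smul_apply, smul_eq_mul] at h ⊢
    linear_combination c * h

end FivePoint

/-! ## PART D — THE TEST CYLINDER `P(U) = |tr U_p|²` AND THE HEADLINE -/

section TestCylinder

variable {d n : ℕ}

/-- The trace of `diag(a, b, c, 1, …, 1)` is `a + b + c + n`. [folklore] -/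
theorem trace_coe_suDiag3 (a b c : ℂ) (ha : ‖a‖ = 1) (hb : ‖b‖ = 1) (hc : ‖c‖ = 1) (habc : a * b * c = 1) :
    ((suDiag3 n a b c ha hb hc habc : Matrix.specialUnitaryGroup (Fin (n + 3)) ℂ) :
      Matrix (Fin (n + 3)) (Fin (n + 3)) ℂ).trace = a + b + c + n := by
  simpa using trace_coe_suDiag3_pow (n := n) a b c ha hb hc habc 1

/-- `tr g_A = n + 1`. [folklore] -/
theorem trace_balA : ((balA n : Matrix.specialUnitaryGroup (Fin (n + 3)) ℂ) : Matrix (Fin (n + 3)) (Fin (n + 3)) ℂ).trace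
    = (n : ℂ) + 1 := by
  rw [balA, trace_coe_suDiag3]; ring
/-- `tr g_E = n - 1`. [folklore] -/
theorem trace_balE : ((balE n : Matrix.specialUnitaryGroup (Fin (n + 3)) ℂ) : Matrix (Fin (n + 3)) (Fin (n + 3)) ℂ).trace
    = (n : ℂ) - 1 := by
  rw [balE, trace_coe_suDiag3]; ring
/-- `tr g_C = n - 1 + 2i`. [folklore] -/
theorem trace_balC : ((balC n : Matrix.specialUnitaryGroup (Fin (n + 3)) ℂ) : Matrix (Fin (n + 3)) (Fin (n + 3)) ℂ).trace
    = (n : ℂ) - 1 + 2 * Complex.I := by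
  rw [balC, trace_coe_suDiag3]; ring
/-- `tr g_D = n - 1 - 2i`. [folklore] -/
theorem trace_balD : ((balD n : Matrix.specialUnitaryGroup (Fin (n + 3)) ℂ) : Matrix (Fin (n + 3)) (Fin (n + 3)) ℂ).trace
    = (n : ℂ) - 1 - 2 * Complex.I := by
  rw [balD, trace_coe_suDiag3]; ring
/-- `tr 1 = n + 3`. [folklore] -/
theorem trace_suN_one : (((1 : Matrix.specialUnitaryGroup (Fin (n + 3)) ℂ)) : Matrix (Fin (n + 3)) (Fin (n + 3)) ℂ).trace
    = (n : ℂ) + 3 := by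
  rw [OneMemClass.coe_one, Matrix.trace_one, Fintype.card_fin]; push_cast; ring

/-- **The test observable** `P(U) = |tr U_p|²`, `p` the plaquette at the origin in the `(0,1)` plane — up to the
additive constant `1` the character of the ADJOINT representation at `U_p`, and the sum of two PRODUCTS of single
Wilson-loop generators: `P = (Re tr U_p)² + (Im tr U_p)²`. [folklore] -/
noncomputable def absTrSqPlaquette (d n : ℕ) (U : LGConfig (d + 2) (Matrix.specialUnitaryGroup (Fin (n + 3)) ℂ)) : ℝ :=
  Complex.normSq ((plaquetteHolonomyZd U 0 0 1 : Matrix.specialUnitaryGroup (Fin (n + 3)) ℂ) :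
    Matrix (Fin (n + 3)) (Fin (n + 3)) ℂ).trace

/-- `P` is gauge invariant (`tr (g U_p g⁻¹) = tr U_p`). [folklore] -/
theorem isZdGaugeInvariant_absTrSqPlaquette : IsZdGaugeInvariant (absTrSqPlaquette d n) := by
  intro g U
  simp only [absTrSqPlaquette, plaquetteHolonomyZd_gaugeTransformZd]
  congr 1
  rw [Submonoid.coe_mul, Submonoid.coe_mul, Matrix.trace_mul_cycle, ← Submonoid.coe_mul, inv_mul_cancel,
    OneMemClass.coe_one, one_mul]

/-- `P` is a cylinder on the four plaquette edges. [folklore] -/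
theorem isCylinder_absTrSqPlaquette :
    IsCylinder (absTrSqPlaquette d n) {((0 : Fin (d + 2) → ℤ), (0 : Fin (d + 2))),
      ((0 : Fin (d + 2) → ℤ) + Pi.single 0 1, 1), ((0 : Fin (d + 2) → ℤ) + Pi.single 1 1, 0),
      ((0 : Fin (d + 2) → ℤ), 1)} := by
  intro U V h
  simp only [absTrSqPlaquette, plaquetteHolonomyZd]
  rw [h _ (by simp), h ((0 : Fin (d + 2) → ℤ) + Pi.single 0 1, 1) (by simp),
    h ((0 : Fin (d + 2) → ℤ) + Pi.single 1 1, 0) (by simp), h ((0 : Fin (d + 2) → ℤ), 1) (by simp)]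

/-- `P` is continuous. [folklore] -/
theorem continuous_absTrSqPlaquette : Continuous (absTrSqPlaquette d n) := by
  have h1 : Continuous fun U : LGConfig (d + 2) (Matrix.specialUnitaryGroup (Fin (n + 3)) ℂ) =>
      plaquetteHolonomyZd U 0 0 1 := by
    unfold plaquetteHolonomyZd; fun_prop
  exact Complex.continuous_normSq.comp (continuous_subtype_val.comp h1).matrix_trace

/-- `|tr g| ≤ n + 3` on `SU(n+3)` (unitary entries have norm `≤ 1`). [folklore] -/
theorem norm_trace_le_suN (g : Matrix.specialUnitaryGroup (Fin (n + 3)) ℂ) :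
    ‖((g : Matrix (Fin (n + 3)) (Fin (n + 3)) ℂ)).trace‖ ≤ (n : ℝ) + 3 := by
  have hU : (g : Matrix (Fin (n + 3)) (Fin (n + 3)) ℂ) ∈ Matrix.unitaryGroup (Fin (n + 3)) ℂ :=
    Matrix.specialUnitaryGroup_le_unitaryGroup g.2
  calc ‖((g : Matrix (Fin (n + 3)) (Fin (n + 3)) ℂ)).trace‖
      = ‖∑ i, (g : Matrix (Fin (n + 3)) (Fin (n + 3)) ℂ) i i‖ := rfl
    _ ≤ ∑ i, ‖(g : Matrix (Fin (n + 3)) (Fin (n + 3)) ℂ) i i‖ := norm_sum_le _ _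
    _ ≤ ∑ _i : Fin (n + 3), (1 : ℝ) := Finset.sum_le_sum fun i _ => entry_norm_bound_of_unitary hU i i
    _ = (n : ℝ) + 3 := by rw [Finset.sum_const, Finset.card_univ, Fintype.card_fin]; norm_num

/-- `|P U| ≤ (n+3)²`. [folklore] -/
theorem abs_absTrSqPlaquette_le (U : LGConfig (d + 2) (Matrix.specialUnitaryGroup (Fin (n + 3)) ℂ)) :
    |absTrSqPlaquette d n U| ≤ ((n : ℝ) + 3) ^ 2 := by
  rw [absTrSqPlaquette, abs_of_nonneg (Complex.normSq_nonneg _), Complex.normSq_eq_norm_sq]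
  exact pow_le_pow_left₀ (norm_nonneg _) (norm_trace_le_suN _) 2

/-- The plaquette holonomy of `U_g` is `g`. [folklore] -/
theorem plaquetteHolonomyZd_cfg (g : Matrix.specialUnitaryGroup (Fin (n + 3)) ℂ) :
    plaquetteHolonomyZd (cfg d n g) 0 0 1 = g := by
  have h1 : cfg d n g ((0 : Fin (d + 2) → ℤ), 0) = g := by simp [cfg, baseEdge, singleEdgeConfig]
  have h2 : cfg d n g ((0 : Fin (d + 2) → ℤ) + Pi.single 0 1, 1) = 1 := by simp [cfg, baseEdge, singleEdgeConfig]
  have h3 : cfg d n g ((0 : Fin (d + 2) → ℤ) + Pi.single 1 1, 0) = 1 := by simp [cfg, baseEdge, singleEdgeConfig]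
  have h4 : cfg d n g ((0 : Fin (d + 2) → ℤ), 1) = 1 := by simp [cfg, baseEdge, singleEdgeConfig]
  rw [plaquetteHolonomyZd, h1, h2, h3, h4, inv_one, mul_one, mul_one, mul_one]

/-- `P(U_g) = |tr g|²`. [folklore] -/
theorem absTrSqPlaquette_cfg (g : Matrix.specialUnitaryGroup (Fin (n + 3)) ℂ) :
    absTrSqPlaquette d n (cfg d n g) = Complex.normSq ((g : Matrix (Fin (n + 3)) (Fin (n + 3)) ℂ).trace) := by
  rw [absTrSqPlaquette, plaquetteHolonomyZd_cfg]

/-- **`Λ(P) = 16`**: `2·((n-1)² + 4) + (n+3)² - 2·(n+1)² - (n-1)² = 16`, independently of `n`. [folklore] -/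
theorem fivePoint_absTrSqPlaquette : fivePoint d n (absTrSqPlaquette d n) = 16 := by
  simp only [fivePoint, absTrSqPlaquette_cfg, trace_balA, trace_balE, trace_balC, trace_balD, trace_suN_one,
    Complex.normSq_apply,
    Complex.add_re, Complex.add_im, Complex.sub_re, Complex.sub_im, Complex.mul_re, Complex.mul_im, Complex.I_re,
    Complex.I_im, Complex.one_re, Complex.one_im, Complex.natCast_re, Complex.natCast_im, Complex.re_ofNat,
    Complex.im_ofNat]
  ring

/-- **HEADLINE — for `SU(N)`, `N ≥ 3` (`d ≥ 2`), THE SINGLE WILSON LOOPS DO NOT SPAN THE GAUGE-INVARIANT CYLINDERS**: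
`¬ SpansGaugeInvariantCylinders (d+2) (range (loopFactor (fundamentalRep (Fin (n+3)))))`.  Proof: the five-point
functional `Λ` vanishes on the span of the single loops and equals `16` on the gauge-invariant continuous bounded
cylinder `P = |tr U_p|²`; a `W` in the span with `sup |P - W| ≤ 1` would give `16 = |Λ(P - W)| ≤ 6`.  Contrast:
for `SU(2)` the single loops DO span (module XXI `spansGaugeInvariantCylinders_loopFactor_su2`, via the Fricke
identity), and for every `N` the PRODUCTS of Wilson loops in the defining representation do (Sengupta 1994 Thm 2
p.900 / Lévy 2004 Thm 3.1 — not formalised; the Mandelstam-identity count is Gambini–Pullin 1996 §3.4.1 (3.44)).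
[folklore] -/
theorem not_spansGaugeInvariantCylinders_loopFactor_suN :
    ¬ SpansGaugeInvariantCylinders (d + 2) (Set.range (loopFactor (d := d + 2) (fundamentalRep (Fin (n + 3))))) := by
  intro h
  obtain ⟨W, hW, hclose⟩ := h (absTrSqPlaquette d n) _ isCylinder_absTrSqPlaquette continuous_absTrSqPlaquette
    ⟨_, abs_absTrSqPlaquette_le⟩ isZdGaugeInvariant_absTrSqPlaquette 1 one_pos
  have hΛW : fivePoint d n W = 0 := fivePoint_eq_zero_of_mem_span hW
  have hΛP : fivePoint d n (absTrSqPlaquette d n) = 16 := fivePoint_absTrSqPlaquette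
  obtain ⟨h1a, h1b⟩ := abs_le.1 (hclose (cfg d n (balC n)))
  obtain ⟨h2a, h2b⟩ := abs_le.1 (hclose (cfg d n (balD n)))
  obtain ⟨h3a, h3b⟩ := abs_le.1 (hclose (cfg d n 1))
  obtain ⟨h4a, h4b⟩ := abs_le.1 (hclose (cfg d n (balA n)))
  obtain ⟨h5a, h5b⟩ := abs_le.1 (hclose (cfg d n (balE n)))
  simp only [fivePoint] at hΛW hΛP
  linarith

/-- The same for every `N ≥ 3` (`N = n + 3`). [folklore] -/
theorem not_spansGaugeInvariantCylinders_loopFactor_of_three_le {N : ℕ} (hN : 3 ≤ N) :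
    ¬ SpansGaugeInvariantCylinders (d + 2) (Set.range (loopFactor (d := d + 2) (fundamentalRep (Fin N)))) := by
  obtain ⟨n, rfl⟩ := Nat.exists_eq_add_of_le' hN
  exact not_spansGaugeInvariantCylinders_loopFactor_suN

/-- **Quantitative form**: every element of the span of the single Wilson loops is at sup-distance `≥ 8/3` from `P`
(`16 = Λ(P - W) ≤ 6 · max |P - W|` over the five test configurations). [folklore] -/
theorem le_dist_absTrSqPlaquette_of_mem_span {W : LGConfig (d + 2) (Matrix.specialUnitaryGroup (Fin (n + 3)) ℂ) → ℝ}
    (hW : W ∈ Submodule.span ℝ (Set.range (loopFactor (d := d + 2) (fundamentalRep (Fin (n + 3)))))) :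
    ∃ U, (8 : ℝ) / 3 ≤ |absTrSqPlaquette d n U - W U| := by
  by_contra hcon
  simp only [not_exists, not_le] at hcon
  have hΛW : fivePoint d n W = 0 := fivePoint_eq_zero_of_mem_span hW
  have hΛP : fivePoint d n (absTrSqPlaquette d n) = 16 := fivePoint_absTrSqPlaquette
  obtain ⟨h1a, h1b⟩ := abs_lt.1 (hcon (cfg d n (balC n)))
  obtain ⟨h2a, h2b⟩ := abs_lt.1 (hcon (cfg d n (balD n)))
  obtain ⟨h3a, h3b⟩ := abs_lt.1 (hcon (cfg d n 1))
  obtain ⟨h4a, h4b⟩ := abs_lt.1 (hcon (cfg d n (balA n)))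
  obtain ⟨h5a, h5b⟩ := abs_lt.1 (hcon (cfg d n (balE n)))
  simp only [fivePoint] at hΛW hΛP
  linarith

end TestCylinder

/-! ## PART E — COROLLARIES: PRODUCTS OF WILSON LOOPS ARE NOT IN THE CLOSED SPAN OF SINGLE LOOPS (`N ≥ 3`),
AND NO PRODUCT-TO-SUM FORMULA OF MODULE XXI'S SHAPE EXISTS -/

section Products

variable {d n : ℕ} {G : Type*} [Group G]

/-- The holonomy of a unit straight walk is the edge variable. [folklore] -/
theorem walkHolonomy_lineWalk_one (U : LGConfig d G) (i : Fin d) (x : Fin d → ℤ) :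
    walkHolonomy U (lineWalk i 1 x) = U (x, i) := by
  rw [lineWalk, walkHolonomy_cons, walkHolonomy_copy, lineWalk, walkHolonomy_copy, walkHolonomy_nil, mul_one,
    dartHolonomy_add_single]

/-- The holonomy of the `1 × 1` rectangular walk is the plaquette holonomy `U_p` (tree `plaquetteHolonomyZd`).
[folklore] -/
theorem walkHolonomy_rectWalk_one_one (U : LGConfig d G) (x : Fin d → ℤ) (i j : Fin d) :
    walkHolonomy U (rectWalk x i j 1 1) = plaquetteHolonomyZd U x i j := by
  simp only [rectWalk, walkHolonomy_append, walkHolonomy_copy, walkHolonomy_reverse, walkHolonomy_lineWalk_one,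
    Nat.cast_one, plaquetteHolonomyZd, mul_assoc]

/-- The plaquette at the origin of `ℤ^{d+2}` in the `(0,1)` plane, as a based loop. [folklore] -/
noncomputable def originPlaquetteLoop (d : ℕ) : Σ x : (Fin (d + 2) → ℤ), (zdGraph (d + 2)).Walk x x :=
  ⟨0, rectWalk 0 0 1 1 1⟩

/-- `P = (Re tr U_p)·(Re tr U_p) + (Im tr U_p)·(Im tr U_p)` is the sum of two Wilson-loop PRODUCTS. [folklore] -/
theorem absTrSqPlaquette_eq_loopProduct_add :
    absTrSqPlaquette d n = loopProduct (ρSU n) [(originPlaquetteLoop d, true), (originPlaquetteLoop d, true)]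
      + loopProduct (ρSU n) [(originPlaquetteLoop d, false), (originPlaquetteLoop d, false)] := by
  funext U
  simp only [Pi.add_apply, loopProduct_cons, loopProduct_nil, loopFactor_eq_tracePart, tracePart, originPlaquetteLoop,
    walkHolonomy_rectWalk_one_one, absTrSqPlaquette, Complex.normSq_apply, fundamentalRep_apply, mul_one]

/-- Hence `P` lies in the span of Lévy's class of Wilson-loop PRODUCTS … [folklore] -/
theorem absTrSqPlaquette_mem_span_wilsonLoopProducts :
    absTrSqPlaquette d n ∈ Submodule.span ℝ (wilsonLoopProducts (ρSU n) (d + 2)) := by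
  rw [absTrSqPlaquette_eq_loopProduct_add]
  exact Submodule.add_mem _ (Submodule.subset_span ⟨_, rfl⟩) (Submodule.subset_span ⟨_, rfl⟩)

/-- **… so for `SU(N)`, `N ≥ 3`, the span of the Wilson-loop PRODUCTS is NOT contained in the span of the SINGLE Wilson
loops** (indeed not in its sup-norm closure: `P` is at distance `≥ 8/3`), in contrast with `SU(2)` (module XXI
`span_wilsonLoopProducts_le_span_loopFactor_of_prod` + Fricke) and `U(1)` (module XX). [folklore] -/
theorem not_span_wilsonLoopProducts_le_span_loopFactor_suN :
    ¬ (Submodule.span ℝ (wilsonLoopProducts (ρSU n) (d + 2)) ≤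
        Submodule.span ℝ (Set.range (loopFactor (d := d + 2) (ρSU n)))) := by
  intro h
  have h0 : fivePoint d n (absTrSqPlaquette d n) = 0 :=
    fivePoint_eq_zero_of_mem_span (h absTrSqPlaquette_mem_span_wilsonLoopProducts)
  rw [fivePoint_absTrSqPlaquette] at h0
  norm_num at h0

/-- `Re tr g_C = n - 1`. [folklore] -/
theorem tracePart_true_balC : tracePart (ρSU n) true (balC n) = n - 1 := by
  simp [tracePart, fundamentalRep_apply, trace_balC]
/-- `Re tr g_D = n - 1`. [folklore] -/
theorem tracePart_true_balD : tracePart (ρSU n) true (balD n) = n - 1 := by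
  simp [tracePart, fundamentalRep_apply, trace_balD]
/-- `Re tr g_A = n + 1`. [folklore] -/
theorem tracePart_true_balA : tracePart (ρSU n) true (balA n) = n + 1 := by
  simp [tracePart, fundamentalRep_apply, trace_balA]
/-- `Re tr g_E = n - 1`. [folklore] -/
theorem tracePart_true_balE : tracePart (ρSU n) true (balE n) = n - 1 := by
  simp [tracePart, fundamentalRep_apply, trace_balE]
/-- `Re tr 1 = n + 3`. [folklore] -/
theorem tracePart_true_suN_one : tracePart (ρSU n) true (1 : Matrix.specialUnitaryGroup (Fin (n + 3)) ℂ) = n + 3 := by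
  simp [tracePart, fundamentalRep_apply]

/-- **NO PRODUCT-TO-SUM FORMULA FOR `SU(N)`, `N ≥ 3`**: the hypothesis `hprod` of module XXI's
`span_wilsonLoopProducts_le_span_loopFactor_of_prod` (`χ_{b₁}(g) χ_{b₂}(h) = c₁ χ_b(gh) + c₂ χ_b(gh⁻¹)`, true for
`U(1)` and, by Fricke, for `SU(2)`) FAILS for the defining representation of `SU(n+3)`: on the diagonal `g = h` of the
five-point family the left side sums (with signs `+,+,+,-2,-`) to `(n-1)²+(n-1)²+(n+3)²-2(n+1)²-(n-1)² = 8`, the right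
side to `c₁ Λ(χ_b(·²)) + c₂ χ_b(1)·0 = 0`. [folklore] -/
theorem not_prod_formula_suN :
    ¬ (∀ b₁ b₂ : Bool, ∃ c₁ c₂ : ℝ, ∃ b : Bool, ∀ g h : Matrix.specialUnitaryGroup (Fin (n + 3)) ℂ,
      tracePart (ρSU n) b₁ g * tracePart (ρSU n) b₂ h =
        c₁ * tracePart (ρSU n) b (g * h) + c₂ * tracePart (ρSU n) b (g * h⁻¹)) := by
  intro hprod
  obtain ⟨c₁, c₂, b, hb⟩ := hprod true true
  have hC := hb (balC n) (balC n)
  have hD := hb (balD n) (balD n)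
  have h1 := hb 1 1
  have hA := hb (balA n) (balA n)
  have hE := hb (balE n) (balE n)
  rw [mul_inv_cancel] at hC hD h1 hA hE
  rw [tracePart_true_balC] at hC
  rw [tracePart_true_balD] at hD
  rw [tracePart_true_suN_one] at h1
  rw [tracePart_true_balA] at hA
  rw [tracePart_true_balE] at hE
  have id2 := tracePart_identity (n := n) b 2
  simp only [pow_two] at id2
  have h8 : (8 : ℝ) = 0 := by linear_combination hC + hD + h1 - 2 * hA - hE + c₁ * id2
  norm_num at h8

/-- In particular module XXI's PART A route to `(W-single)`-density is closed for `N ≥ 3`: its two hypotheses cannot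
both hold (the conclusion is refuted by `not_span_wilsonLoopProducts_le_span_loopFactor_suN`). [folklore] -/
theorem xxi_partA_hypotheses_fail_suN
    (hprod : ∀ b₁ b₂ : Bool, ∃ c₁ c₂ : ℝ, ∃ b : Bool, ∀ g h : Matrix.specialUnitaryGroup (Fin (n + 3)) ℂ,
      tracePart (ρSU n) b₁ g * tracePart (ρSU n) b₂ h =
        c₁ * tracePart (ρSU n) b (g * h) + c₂ * tracePart (ρSU n) b (g * h⁻¹)) : False :=
  not_prod_formula_suN hprod

end Products

/-! ## PART F — STATE-LEVEL FORM: TWO PROBABILITY MEASURES WITH THE SAME SINGLE-LOOP EXPECTATIONS -/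

section States

open MeasureTheory
open scoped ENNReal

variable {d n : ℕ}

/-- The state `μ = (δ_{U_{g_C}} + δ_{U_{g_D}} + δ_{U_1}) / 3`. [folklore] -/
noncomputable def stateμ (d n : ℕ) : Measure (LGConfig (d + 2) (Matrix.specialUnitaryGroup (Fin (n + 3)) ℂ)) :=
  (3 : ℝ≥0∞)⁻¹ • (Measure.dirac (cfg d n (balC n)) + Measure.dirac (cfg d n (balD n)) + Measure.dirac (cfg d n 1))

/-- The state `ν = (2 δ_{U_{g_A}} + δ_{U_{g_E}}) / 3`. [folklore] -/
noncomputable def stateν (d n : ℕ) : Measure (LGConfig (d + 2) (Matrix.specialUnitaryGroup (Fin (n + 3)) ℂ)) :=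
  (3 : ℝ≥0∞)⁻¹ • (Measure.dirac (cfg d n (balA n)) + Measure.dirac (cfg d n (balA n)) + Measure.dirac (cfg d n (balE n)))

/-- `3⁻¹ · (1 + 1 + 1) = 1` in `ℝ≥0∞`. [folklore] -/
theorem three_inv_mul_three : (3 : ℝ≥0∞)⁻¹ * (1 + 1 + 1) = 1 := by
  rw [show (1 : ℝ≥0∞) + 1 + 1 = 3 by norm_num]
  exact ENNReal.inv_mul_cancel (by norm_num) (by simp)

/-- `μ` is a probability measure. [folklore] -/
instance isProbabilityMeasure_stateμ : IsProbabilityMeasure (stateμ d n) :=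
  ⟨by simp only [stateμ, Measure.smul_apply, Measure.add_apply, measure_univ, smul_eq_mul, three_inv_mul_three]⟩

/-- `ν` is a probability measure. [folklore] -/
instance isProbabilityMeasure_stateν : IsProbabilityMeasure (stateν d n) :=
  ⟨by simp only [stateν, Measure.smul_apply, Measure.add_apply, measure_univ, smul_eq_mul, three_inv_mul_three]⟩

/-- Integration against a convex combination of three Dirac masses (every function; singletons are measurable in the
countable product `LGConfig`). [folklore] -/
theorem integral_third_dirac3 (U₁ U₂ U₃ : LGConfig (d + 2) (Matrix.specialUnitaryGroup (Fin (n + 3)) ℂ))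
    (F : LGConfig (d + 2) (Matrix.specialUnitaryGroup (Fin (n + 3)) ℂ) → ℝ) :
    ∫ U, F U ∂((3 : ℝ≥0∞)⁻¹ • (Measure.dirac U₁ + Measure.dirac U₂ + Measure.dirac U₃)) = (F U₁ + F U₂ + F U₃) / 3 := by
  have i1 : Integrable F (Measure.dirac U₁) := integrable_dirac (by simp)
  have i2 : Integrable F (Measure.dirac U₂) := integrable_dirac (by simp)
  have i3 : Integrable F (Measure.dirac U₃) := integrable_dirac (by simp)
  rw [integral_smul_measure, integral_add_measure (i1.add_measure i2) i3, integral_add_measure i1 i2,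
    integral_dirac, integral_dirac, integral_dirac, ENNReal.toReal_inv]
  norm_num
  ring

/-- Expectations in `μ`. [folklore] -/
theorem integral_stateμ (F : LGConfig (d + 2) (Matrix.specialUnitaryGroup (Fin (n + 3)) ℂ) → ℝ) :
    ∫ U, F U ∂(stateμ d n) = (F (cfg d n (balC n)) + F (cfg d n (balD n)) + F (cfg d n 1)) / 3 :=
  integral_third_dirac3 _ _ _ F

/-- Expectations in `ν`. [folklore] -/
theorem integral_stateν (F : LGConfig (d + 2) (Matrix.specialUnitaryGroup (Fin (n + 3)) ℂ) → ℝ) :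
    ∫ U, F U ∂(stateν d n) = (F (cfg d n (balA n)) + F (cfg d n (balA n)) + F (cfg d n (balE n))) / 3 :=
  integral_third_dirac3 _ _ _ F

/-- **`μ` and `ν` have THE SAME EXPECTATION OF EVERY SINGLE WILSON LOOP** (real and imaginary parts, every loop of
`ℤ^{d+2}`, defining representation of `SU(n+3)`) … [folklore] -/
theorem integral_loopFactor_stateμ_eq_stateν (p : (Σ x : (Fin (d + 2) → ℤ), (zdGraph (d + 2)).Walk x x) × Bool) :
    ∫ U, loopFactor (ρSU n) p U ∂(stateμ d n) = ∫ U, loopFactor (ρSU n) p U ∂(stateν d n) := by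
  rw [integral_stateμ, integral_stateν]
  have h := fivePoint_loopFactor (d := d) (n := n) p
  simp only [fivePoint] at h
  linarith

/-- **… but DIFFERENT expectations of the gauge-invariant cylinder `P = |tr U_p|²`** (they differ by `16/3`). [folklore] -/
theorem integral_absTrSqPlaquette_stateμ_sub_stateν :
    ∫ U, absTrSqPlaquette d n U ∂(stateμ d n) - ∫ U, absTrSqPlaquette d n U ∂(stateν d n) = 16 / 3 := by
  rw [integral_stateμ, integral_stateν]
  have h := fivePoint_absTrSqPlaquette (d := d) (n := n)
  simp only [fivePoint] at h
  linarith

/-- **STATE-LEVEL HEADLINE: for `SU(N)`, `N ≥ 3`, `d ≥ 2`, the single-Wilson-loop expectations do NOT determine a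
probability measure on `LGConfig`, not even its restriction to gauge-invariant cylinder observables.** [folklore] -/
theorem exists_states_agree_on_single_loops_suN :
    ∃ μ ν : Measure (LGConfig (d + 2) (Matrix.specialUnitaryGroup (Fin (n + 3)) ℂ)),
      IsProbabilityMeasure μ ∧ IsProbabilityMeasure ν ∧
      (∀ p : (Σ x : (Fin (d + 2) → ℤ), (zdGraph (d + 2)).Walk x x) × Bool,
        ∫ U, loopFactor (fundamentalRep (Fin (n + 3))) p U ∂μ = ∫ U, loopFactor (fundamentalRep (Fin (n + 3))) p U ∂ν) ∧
      ∃ F : LGConfig (d + 2) (Matrix.specialUnitaryGroup (Fin (n + 3)) ℂ) → ℝ,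
        IsZdGaugeInvariant F ∧ IsLocalObservable F ∧ Continuous F ∧ ∫ U, F U ∂μ ≠ ∫ U, F U ∂ν :=
  ⟨stateμ d n, stateν d n, inferInstance, inferInstance, integral_loopFactor_stateμ_eq_stateν,
    absTrSqPlaquette d n, isZdGaugeInvariant_absTrSqPlaquette, ⟨_, isCylinder_absTrSqPlaquette⟩,
    continuous_absTrSqPlaquette, fun h => by
      have := integral_absTrSqPlaquette_stateμ_sub_stateν (d := d) (n := n)
      rw [h, sub_self] at this
      norm_num at this⟩

end States

end Literature.MathematicalPhysics.QuantumFieldTheory
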